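import Mathlib.GroupTheory.Perm.Finite
import Mathlib.LinearAlgebra.Determinant
import Mathlib.LinearAlgebra.FiniteDimensional.Lemmas
import Literature.NumberTheory.Transcendental.L2HodgeTheory
import HarnessLib

/-!
# `⟪α, β⟫_{L²} = ∫_M α ∧ ⋆β` proved: discharge of `MForm.l2Inner_eq_integral_wedge_hodgeStar`

Topic `NumberTheory/Transcendental` (trunk TranscendKaehlerL, item C11 `L2HodgeTheory`). Sibling
proof file of `L2HodgeTheory.lean` (which stays untouched); it DISCHARGES the named fact
`Literature.Geometry.Kaehler.MForm.l2Inner_eq_integral_wedge_hodgeStar` of that file: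

* `Literature.Geometry.Kaehler.MForm.l2Inner_eq_integral_wedge_hodgeStar_holds` — for all degrees
  `k + m = n` and all `k`-forms `α`, `β` on an oriented Riemannian `n`-manifold,
  `⟪α, β⟫_{L²} = ∫_M α ∧ ⋆β` (Warner (1983), 6.1 (5), p. 221; Jost, §3.3).

Since `⟪α, β⟫_{L²}` is *defined* (C11) as `∫_M ⟪α, β⟫ vol`, the content is the pointwise identity
of top forms `α ∧ ⋆β = ⟪α, β⟫ vol` characterising the Hodge star (Warner (1983), Ex. 2.13 (6),
p. 80: `⟨v, w⟩ = ⋆(v ∧ ⋆w)`; Jost, Lemma 3.3.1), for the concrete `⋆` of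
`Literature/Geometry/Kaehler/HodgeStar.lean`
(`(⋆β)(w) = ∑_{|s| = k} β(b_s) vol(b_s, w)`, `b` the standard orthonormal basis, `s` increasing
multi-indices), the concrete inner product `⟪α, β⟫ = ∑_s α(b_s) β(b_s)` and the shuffle-normalised
wedge `(α ∧ γ)(v) = (k! m!)⁻¹ ∑_σ sign σ · α(v ∘ σ|₁) γ(v ∘ σ|₂)` of `FormsAlgebra.lean`.

Proof (linear algebra on an oriented inner product space `V`, `finrank V = n`):

1. *Block lemma* `wedge_apply_append_eq_mul`: if the `m`-form `γ` vanishes on every tuple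
   containing one of the vectors `v 0, …, v (k-1)`, then `(α ∧ γ)(v, w) = α(v) γ(w)`. In the
   permutation sum, indexed by `Perm (Fin k ⊕ Fin m)`, a permutation outside the block subgroup
   `Perm (Fin k) × Perm (Fin m)` moves some `w`-slot onto a `v`-vector, so its term vanishes; the
   `k! m!` block permutations `(τ₁, τ₂)` each contribute `sign τ₁ sign τ₂ · sign τ₁ α(v) ·
   sign τ₂ γ(w) = α(v) γ(w)` (the pattern of Mathlib's `Matrix.det_fromBlocks_zero₂₁`).
2. `wedge_interiorProductMulti_volumeFormL`: for each increasing multi-index `s`,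
   `α ∧ ι_{b_s} vol = α(b_s) vol` as `(k + m)`-forms: two top-degree forms agree once they agree
   on one basis (`AlternatingMap.eq_smul_basis_det`), and on the adapted basis `(b_s, b_{sᶜ})`
   both sides equal `α(b_s) vol(b_s, b_{sᶜ})` by the block lemma (a tuple `(b_s, w')` with
   `w' j = b_s i` has a repeated entry, so `vol` kills it).
3. `domDomCongr_wedge_hodgeStar`: `⋆β = ∑_s β(b_s) ι_{b_s} vol`, `∧` is additive on the right,
   and `∑_s β(b_s) α(b_s) = ⟪α, β⟫`, whence `α ∧ ⋆β = ⟪α, β⟫ vol`.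
4. On the manifold the two integrands of `MForm.integral o` agree pointwise; both wedge products
   (the one of `MForm.wedge`, computed on the model space `E`, and the one of step 3 on the
   Riemannian tangent space) are unfolded by the shuffle formula `wedge_apply`, after which they
   are the same sum.

## References

* F. W. Warner, *Foundations of Differentiable Manifolds and Lie Groups*, GTM 94, Springer (1983),
  Ex. 2.13 (3)–(6), pp. 79–80 (`⋆`, `⟨v, w⟩ = ⋆(v ∧ ⋆w)`), 6.1 (5), p. 221
  (`⟨α, β⟩ = ∫_M α ∧ ⋆β`) [Warner1983].
* J. Jost, *Riemannian Geometry and Geometric Analysis*, §3.3, Lemma 3.3.1.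
* Mathlib `Mathlib/LinearAlgebra/Matrix/Determinant/Basic.lean` (`Matrix.det_fromBlocks_zero₂₁`,
  the block-permutation argument), `Mathlib/GroupTheory/Perm/Finite.lean`
  (`Equiv.Perm.mem_sumCongrHom_range_of_perm_mapsTo_inl`).
-/

noncomputable section

open scoped Manifold ContDiff Topology
open Bundle Module ContinuousAlternatingMap

namespace Literature.NumberTheory.Transcendental

/-! ### Step 1: the block lemma for the wedge product -/

section Wedge

variable {V : Type*} [NormedAddCommGroup V] [NormedSpace ℝ V] {k l : ℕ}

open Equiv Equiv.Perm in
/-- Summing a function on `Perm (ι₁ ⊕ ι₂)` that vanishes off the block subgroup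
`Perm ι₁ × Perm ι₂` (the range of `Equiv.Perm.sumCongrHom`) and is constant `= c` on it gives
`|Perm ι₁ × Perm ι₂| • c` (the bookkeeping behind Mathlib's `Matrix.det_fromBlocks_zero₂₁`). [folklore] -/
theorem sum_perm_sum_eq_card_smul {ι₁ ι₂ : Type*} [Fintype ι₁] [Fintype ι₂] [DecidableEq ι₁]
    [DecidableEq ι₂] {R : Type*} [AddCommMonoid R] (G : Perm (ι₁ ⊕ ι₂) → R) (c : R)
    (h₁ : ∀ p : Perm ι₁ × Perm ι₂, G (sumCongrHom ι₁ ι₂ p) = c)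
    (h₀ : ∀ ρ : Perm (ι₁ ⊕ ι₂), ρ ∉ (sumCongrHom ι₁ ι₂).range → G ρ = 0) :
    ∑ ρ, G ρ = Fintype.card (Perm ι₁ × Perm ι₂) • c := by
  classical
  calc ∑ ρ, G ρ = ∑ ρ ∈ (Finset.univ.map ⟨sumCongrHom ι₁ ι₂, sumCongrHom_injective⟩), G ρ := by
        refine (Finset.sum_subset (Finset.subset_univ _) fun ρ _ hρ ↦ h₀ ρ fun hr ↦ hρ ?_).symm
        obtain ⟨p, hp⟩ := MonoidHom.mem_range.1 hr
        exact Finset.mem_map.2 ⟨p, Finset.mem_univ _, hp⟩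
    _ = ∑ p : Perm ι₁ × Perm ι₂, G (sumCongrHom ι₁ ι₂ p) := by
        rw [Finset.sum_map]
        rfl
    _ = Fintype.card (Perm ι₁ × Perm ι₂) • c := by
        simp_rw [h₁]
        rw [Finset.sum_const, Finset.card_univ]

open Equiv Equiv.Perm in
/-- **Block lemma for the wedge product.** If the `l`-form `γ` vanishes on every tuple one of
whose entries is one of the vectors `v 0, …, v (k-1)`, then `(α ∧ γ)(v, w) = α(v) · γ(w)`: in the
shuffle formula for `(α ∧ γ)(v, w)` (Warner (1983), 2.10(b)) only the `k! l!` permutations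
preserving the two blocks survive, each contributing `α(v) γ(w)`. [folklore] -/
theorem wedge_apply_append_eq_mul (α : V [⋀^Fin k]→L[ℝ] ℝ) (γ : V [⋀^Fin l]→L[ℝ] ℝ)
    (v : Fin k → V) (w : Fin l → V)
    (hγ : ∀ (w' : Fin l → V) (j : Fin l) (i : Fin k), w' j = v i → γ w' = 0) :
    α.wedge γ (Fin.append v w) = α v * γ w := by
  classical
  rw [wedge_apply, ← Equiv.sum_comp (permCongr finSumFinEquiv)]
  have hU : ∀ y, Fin.append v w (finSumFinEquiv y) = Sum.elim v w y := fun y ↦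
    congrFun (Fin.append_comp_sumElim (xs := v) (ys := w)) y
  simp only [permCongr_apply, sign_permCongr, finSumFinEquiv_symm_apply_castAdd,
    finSumFinEquiv_symm_apply_natAdd, hU]
  set G : Perm (Fin k ⊕ Fin l) → ℝ := fun ρ ↦ Equiv.Perm.sign ρ •
    (α (fun i ↦ Sum.elim v w (ρ (Sum.inl i))) * γ (fun j ↦ Sum.elim v w (ρ (Sum.inr j)))) with hG
  -- block permutations contribute `α v * γ w` each
  have h₁ : ∀ p : Perm (Fin k) × Perm (Fin l), G (sumCongrHom _ _ p) = α v * γ w := by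
    rintro ⟨τ₁, τ₂⟩
    have hα : α (fun i ↦ v (τ₁ i)) = ((Equiv.Perm.sign τ₁ : ℤ) : ℝ) * α v := by
      have hp := α.toAlternatingMap.map_perm v τ₁
      rwa [coe_toAlternatingMap, Units.smul_def, zsmul_eq_mul] at hp
    have hγ' : γ (fun j ↦ w (τ₂ j)) = ((Equiv.Perm.sign τ₂ : ℤ) : ℝ) * γ w := by
      have hp := γ.toAlternatingMap.map_perm w τ₂
      rwa [coe_toAlternatingMap, Units.smul_def, zsmul_eq_mul] at hp
    have hs₁ : ((Equiv.Perm.sign τ₁ : ℤ) : ℝ) * ((Equiv.Perm.sign τ₁ : ℤ) : ℝ) = 1 := by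
      rw [← Int.cast_mul, ← Units.val_mul, Int.units_mul_self, Units.val_one, Int.cast_one]
    have hs₂ : ((Equiv.Perm.sign τ₂ : ℤ) : ℝ) * ((Equiv.Perm.sign τ₂ : ℤ) : ℝ) = 1 := by
      rw [← Int.cast_mul, ← Units.val_mul, Int.units_mul_self, Units.val_one, Int.cast_one]
    simp only [G, sumCongrHom_apply, Perm.sumCongr_apply, Sum.map_inl, Sum.map_inr, Sum.elim_inl,
      Sum.elim_inr, sign_sumCongr, hα, hγ', Units.smul_def, zsmul_eq_mul, Units.val_mul,
      Int.cast_mul]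
    calc ((Equiv.Perm.sign τ₁ : ℤ) : ℝ) * ((Equiv.Perm.sign τ₂ : ℤ) : ℝ) *
          (((Equiv.Perm.sign τ₁ : ℤ) : ℝ) * α v * (((Equiv.Perm.sign τ₂ : ℤ) : ℝ) * γ w))
        = (((Equiv.Perm.sign τ₁ : ℤ) : ℝ) * ((Equiv.Perm.sign τ₁ : ℤ) : ℝ)) *
            (((Equiv.Perm.sign τ₂ : ℤ) : ℝ) * ((Equiv.Perm.sign τ₂ : ℤ) : ℝ)) * (α v * γ w) := by
          ring
      _ = α v * γ w := by rw [hs₁, hs₂, one_mul, one_mul]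
  -- the other permutations move some `w`-slot onto a `v`-vector: their term vanishes
  have h₀ : ∀ ρ : Perm (Fin k ⊕ Fin l), ρ ∉ (sumCongrHom _ _).range → G ρ = 0 := by
    intro ρ hρ
    have h' : ¬ Set.MapsTo ρ (Set.range Sum.inr) (Set.range Sum.inr) := fun hh ↦
      hρ (mem_sumCongrHom_range_of_perm_mapsTo_inl ((perm_mapsTo_inl_iff_mapsTo_inr ρ).2 hh))
    unfold Set.MapsTo at h'
    push Not at h'
    obtain ⟨x, ⟨j₀, rfl⟩, hx⟩ := h'
    obtain ⟨i₀, hi₀⟩ : ∃ i₀, ρ (Sum.inr j₀) = Sum.inl i₀ := by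
      rcases hρj : ρ (Sum.inr j₀) with i | j
      · exact ⟨i, rfl⟩
      · exact absurd (⟨j, hρj.symm⟩ : ρ (Sum.inr j₀) ∈ Set.range Sum.inr) hx
    have h0 : γ (fun j ↦ Sum.elim v w (ρ (Sum.inr j))) = 0 :=
      hγ _ j₀ i₀ (by rw [hi₀, Sum.elim_inl])
    simp only [G, h0, mul_zero, smul_zero]
  change ((k.factorial * l.factorial : ℕ) : ℝ)⁻¹ • ∑ ρ, G ρ = α v * γ w
  rw [sum_perm_sum_eq_card_smul G (α v * γ w) h₁ h₀, Fintype.card_prod, Fintype.card_perm,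
    Fintype.card_perm, Fintype.card_fin, Fintype.card_fin, ← Nat.cast_smul_eq_nsmul ℝ, smul_smul,
    inv_mul_cancel₀ (Nat.cast_ne_zero.2 (Nat.mul_ne_zero (Nat.factorial_ne_zero k)
      (Nat.factorial_ne_zero l))), one_smul]

/-- The wedge product is additive in the right factor over finite sums,
`α ∧ ∑ᵢ γᵢ = ∑ᵢ α ∧ γᵢ` (Warner (1983), 2.6: `∧` is bilinear). [cite: Warner1983, 2.6] -/
theorem wedge_sum_right {ι : Type*} (t : Finset ι) (α : V [⋀^Fin k]→L[ℝ] ℝ)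
    (γ : ι → V [⋀^Fin l]→L[ℝ] ℝ) : α.wedge (∑ i ∈ t, γ i) = ∑ i ∈ t, α.wedge (γ i) :=
  map_sum (AddMonoidHom.mk' (fun γ' : V [⋀^Fin l]→L[ℝ] ℝ ↦ α.wedge γ') (wedge_add_right α)) γ t

/-- Two continuous alternating forms of top degree (indexed by the index type of a basis) that
agree on that basis are equal (from Mathlib's `AlternatingMap.eq_smul_basis_det`: a top form is
its value on the basis times the basis determinant). [folklore] -/
theorem eq_of_apply_basis_eq {W : Type*} [AddCommGroup W] [Module ℝ W] [TopologicalSpace W]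
    {ι : Type*} [Fintype ι] [DecidableEq ι] (c : Basis ι ℝ W) {f g : W [⋀^ι]→L[ℝ] ℝ}
    (hfg : f c = g c) : f = g := by
  apply toAlternatingMap_injective
  rw [f.toAlternatingMap.eq_smul_basis_det c, g.toAlternatingMap.eq_smul_basis_det c,
    coe_toAlternatingMap, coe_toAlternatingMap, hfg]

end Wedge

/-! ### Steps 2–3: `α ∧ ⋆β = ⟪α, β⟫ vol` on an oriented inner product space -/

section HodgeStar

open Literature.Geometry.Kaehler Set.powersetCard

variable {V : Type*} [NormedAddCommGroup V] [InnerProductSpace ℝ V] [FiniteDimensional ℝ V]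
  {n : ℕ} [Fact (finrank ℝ V = n)] (o : Orientation ℝ V (Fin n)) {k m : ℕ}

/-- The Hodge star as a finite sum of forms: `⋆β = ∑_{|s| = k} β(b_s) • ι_{b_s} vol`
(Warner (1983), Ex. 2.13; this is the definition of `Literature.Geometry.Kaehler.hodgeStar`,
read at the level of forms rather than of their values). [cite: Warner1983, Ex. 2.13] -/
theorem hodgeStar_eq_sum_smul (h : k + m = n) (β : V [⋀^Fin k]→L[ℝ] ℝ) :
    hodgeStar o h β = ∑ s : Set.powersetCard (Fin n) k,
      β ((stdOrthonormalBasisFin V n).multiIndex s) •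
        (o.volumeFormL.domDomCongr (finCongr (show n = m + k by omega))).interiorProductMulti k
          ((stdOrthonormalBasisFin V n).multiIndex s) := by
  ext w
  rw [hodgeStar_apply, ContinuousAlternatingMap.sum_apply]
  simp only [ContinuousAlternatingMap.smul_apply, smul_eq_mul]

/-- **`α ∧ ι_{b_s} vol = α(b_s) vol`** for every increasing multi-index `s` of length `k`
(`b` the standard orthonormal basis, `ι_{b_s} vol = vol(b_s, ·)` the `m`-form of
`Literature.Geometry.Kaehler.hodgeStar`, `k + m = n`; the `n`-form `vol` is read in degree
`k + m`). Both sides are top-degree forms, so it suffices to compare them on the adapted basis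
`(b_s, b_{sᶜ})`, where the block lemma applies because `vol(b_s, w') = 0` as soon as some
`w' j` is one of the `b_s i`. This is the computation `e^s ∧ ⋆e^s = vol` of Warner (1983),
Ex. 2.13, for the summands of `⋆`. [cite: Warner1983, Ex. 2.13] -/
theorem wedge_interiorProductMulti_volumeFormL (h : k + m = n) (α : V [⋀^Fin k]→L[ℝ] ℝ)
    (s : Set.powersetCard (Fin n) k) :
    α.wedge ((o.volumeFormL.domDomCongr (finCongr (show n = m + k by omega))).interiorProductMulti
        k ((stdOrthonormalBasisFin V n).multiIndex s)) =
      α ((stdOrthonormalBasisFin V n).multiIndex s) •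
        o.volumeFormL.domDomCongr (finCongr h.symm) := by
  classical
  have hcard : m + k = Fintype.card (Fin n) := by rw [Fintype.card_fin]; omega
  -- the complementary multi-index and the adapted basis `(b_s, b_{sᶜ})`
  set t : Set.powersetCard (Fin n) m := Set.powersetCard.compl hcard s with ht
  set u : Fin (k + m) → V := Fin.append ((stdOrthonormalBasisFin V n).multiIndex s)
    ((stdOrthonormalBasisFin V n).multiIndex t) with hu
  have hπ : Function.Injective
      (Fin.append (⇑(ofFinEmbEquiv.symm s)) (⇑(ofFinEmbEquiv.symm t))) := by
    refine Fin.append_injective_iff.2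
      ⟨(ofFinEmbEquiv.symm s).injective, (ofFinEmbEquiv.symm t).injective, fun i j hij ↦ ?_⟩
    have hi : (ofFinEmbEquiv.symm s) i ∈ s := (mem_range_ofFinEmbEquiv_symm_iff_mem s _).1 ⟨i, rfl⟩
    have hj : (ofFinEmbEquiv.symm t) j ∈ t := (mem_range_ofFinEmbEquiv_symm_iff_mem t _).1 ⟨j, rfl⟩
    rw [ht, Set.powersetCard.mem_compl] at hj
    exact hj (hij ▸ hi)
  have hbu : u = ⇑(stdOrthonormalBasisFin V n) ∘
      Fin.append (⇑(ofFinEmbEquiv.symm s)) (⇑(ofFinEmbEquiv.symm t)) := by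
    funext i
    refine Fin.addCases (fun i ↦ ?_) (fun j ↦ ?_) i
    · simp only [hu, Fin.append_left, Function.comp_apply, OrthonormalBasis.multiIndex_apply]
    · simp only [hu, Fin.append_right, Function.comp_apply, OrthonormalBasis.multiIndex_apply]
  have hli : LinearIndependent ℝ u := by
    rw [hbu]
    exact ((stdOrthonormalBasisFin V n).orthonormal.comp _ hπ).linearIndependent
  have hcard' : Fintype.card (Fin (k + m)) = finrank ℝ V := by
    rw [Fintype.card_fin, h]
    exact (Fact.out : finrank ℝ V = n).symm
  have hc : ⇑(basisOfLinearIndependentOfCardEqFinrank' u hli hcard') = u :=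
    coe_basisOfLinearIndependentOfCardEqFinrank' u hli hcard'
  refine eq_of_apply_basis_eq (basisOfLinearIndependentOfCardEqFinrank' u hli hcard') ?_
  rw [hc, hu, wedge_apply_append_eq_mul]
  · -- both sides are `α(b_s) · vol(b_s, b_{sᶜ})`
    rw [ContinuousAlternatingMap.smul_apply, smul_eq_mul, interiorProductMulti_apply,
      domDomCongr_apply, domDomCongr_apply]
    rfl
  · -- `vol(b_s, w') = 0` when some `w' j` is a `b_s i` (repeated entry)
    intro w' j i hji
    rw [interiorProductMulti_apply, domDomCongr_apply]
    refine ContinuousAlternatingMap.map_eq_zero_of_eq _ _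
      (i := Fin.cast h (Fin.castAdd m i)) (j := Fin.cast h (Fin.natAdd k j)) ?_ ?_
    · change Fin.append ((stdOrthonormalBasisFin V n).multiIndex s) w' (Fin.castAdd m i) =
        Fin.append ((stdOrthonormalBasisFin V n).multiIndex s) w' (Fin.natAdd k j)
      rw [Fin.append_left, Fin.append_right, hji]
    · intro hij
      have hv := congrArg Fin.val hij
      simp only [Fin.val_cast, Fin.val_castAdd, Fin.val_natAdd] at hv
      omega

/-- **`α ∧ ⋆β = ⟪α, β⟫ vol`**, the identity characterising the Hodge star (Warner (1983),
Ex. 2.13 (6): `⟨v, w⟩ = ⋆(v ∧ ⋆w)`; Jost, Lemma 3.3.1), for the Hodge star, inner product of forms and volume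
form of `Literature/Geometry/Kaehler/HodgeStar.lean` and the wedge product of `FormsAlgebra.lean`;
the `(k + m)`-form `α ∧ ⋆β` is read in degree `n` along `h : k + m = n`. Proof: expand
`⋆β = ∑_s β(b_s) ι_{b_s} vol`, use `wedge_interiorProductMulti_volumeFormL` termwise and
`∑_s β(b_s) α(b_s) = ⟪α, β⟫`. [cite: Warner1983, Ex. 2.13 (6)] -/
theorem domDomCongr_wedge_hodgeStar (h : k + m = n) (α β : V [⋀^Fin k]→L[ℝ] ℝ) :
    (α.wedge (hodgeStar o h β)).domDomCongr (finCongr h) =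
      alternatingFormInner V n k α β • o.volumeFormL := by
  rw [hodgeStar_eq_sum_smul o h β, wedge_sum_right]
  simp_rw [wedge_smul_right, wedge_interiorProductMulti_volumeFormL o h α, smul_smul]
  rw [← Finset.sum_smul, domDomCongr_smul, ← domDomCongr_trans, alternatingFormInner_apply]
  congr 1
  exact Finset.sum_congr rfl fun s _ ↦ mul_comm _ _

/-- Applied form of `domDomCongr_wedge_hodgeStar`: `(α ∧ ⋆β)(u) = ⟪α, β⟫ vol(u)` for every
`n`-tuple `u` (read in degree `k + m`). [cite: Warner1983, Ex. 2.13 (6)] -/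
theorem wedge_hodgeStar_apply (h : k + m = n) (α β : V [⋀^Fin k]→L[ℝ] ℝ) (u : Fin n → V) :
    α.wedge (hodgeStar o h β) (fun i ↦ u (Fin.cast h i)) =
      alternatingFormInner V n k α β * o.volumeFormL u := by
  have hu := congrFun (congrArg DFunLike.coe (domDomCongr_wedge_hodgeStar o h α β)) u
  rw [domDomCongr_apply, ContinuousAlternatingMap.smul_apply, smul_eq_mul] at hu
  exact hu

end HodgeStar

/-! ### Step 4: the discharge on the manifold -/

section Manifold

variable {E : Type*} [NormedAddCommGroup E] [NormedSpace ℝ E] [FiniteDimensional ℝ E]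
  {n : ℕ} [Fact (finrank ℝ E = n)] [MeasurableSpace E] [BorelSpace E]
  {H : Type*} [TopologicalSpace H] {I : ModelWithCorners ℝ E H}
  {M : Type*} [TopologicalSpace M] [ChartedSpace H M] [T2Space M] [SigmaCompactSpace M]
  [IsManifold I ∞ M] [RiemannianBundle (fun x : M ↦ TangentSpace I x)]
  (o : (x : M) → Orientation ℝ (TangentSpace I x) (Fin n)) {k m : ℕ}

open Literature.Geometry.Kaehler (MForm)
open Literature.Geometry.Kaehler.MForm

/-- **`⟪α, β⟫_{L²} = ∫_M α ∧ ⋆β`** (discharge of the named fact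
`Literature.Geometry.Kaehler.MForm.l2Inner_eq_integral_wedge_hodgeStar`): on an oriented Riemannian
`n`-manifold, for `h : k + m = n` and any `k`-forms `α`, `β`, the `L²` inner product
`∫_M ⟪α, β⟫ vol_o` equals the integral of the top form `α ∧ ⋆β` (moved to degree `n` by
`castDeg h`). The two integrands agree pointwise by `α ∧ ⋆β = ⟪α, β⟫ vol`
(`domDomCongr_wedge_hodgeStar`); no smoothness or compactness is needed. Warner (1983), 6.1 (5),
p. 221 (the definition `⟨α, β⟩ = ∫_M α ∧ ⋆β`) with Ex. 2.13 (6), p. 80 (`⟨v, w⟩ = ⋆(v ∧ ⋆w)`);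
Jost, §3.3, Lemma 3.3.1. [cite: Warner1983, 6.1 (5)] -/
theorem _root_.Literature.Geometry.Kaehler.MForm.l2Inner_eq_integral_wedge_hodgeStar_holds :
    l2Inner_eq_integral_wedge_hodgeStar (k := k) (m := m) o := by
  intro h α β
  unfold l2Inner
  congr 1
  funext x
  ext u
  rw [castDeg_apply, ContinuousAlternatingMap.smul_apply,
    Literature.Geometry.Kaehler.riemannianVolumeForm_apply, MForm.inner, smul_eq_mul,
    ← wedge_hodgeStar_apply (o x) h (α x) (β x) u, ContinuousAlternatingMap.wedge_apply]
  -- the right-hand side is the wedge product computed on the model space `E` (`MForm.wedge`);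
  -- its shuffle expansion is literally the same sum
  exact (ContinuousAlternatingMap.wedge_apply (V := E) (α x) (MForm.hodgeStar o h β x)
    (fun i ↦ u (Fin.cast h i))).symm

end Manifold

end Literature.NumberTheory.Transcendental
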